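import Mathlib
import HarnessLib
import Summits.PneNP.PneNP.Theorems.AeaCutRectanglesTransversalEngine
import Summits.PneNP.PneNP.Theorems.AeaCutRectanglesDutyRectangles
import Summits.PneNP.PneNP.Theorems.AeaCutRectanglesClassCuts

/-!
# Crux FoolingMeasure (stmt-PneNP-19727) — p4 g6: two typed walls for the unit engine
  (WITNESS-RANK wall and INDEPENDENT-HALF wall)

Companion to `Cruxes/FoolingMeasure/BarrierNotesP4g6.md`.  As in `UnitFloor.lean` (p4 g5) everything concerns the
HYPOTHESIS of `AeaCutRectanglesFixedCutFooling.foolingMeasure_of_spreadSystem` (frame `W`, units `π i` of two pairs,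
D1 cover over transversals, D2 witnesses, SPREAD over near-balanced cuts) — never `FoolingMeasure` itself.

Main results (all sorry-free):

* `privateZero_le_rank` — **WITNESS-RANK WALL, abstract form.**  Over `ZMod 3`, if quantities
  `Δ i j = a i + ∑ k, y j k * d i k` (`i j : Fin m`, `k : Fin r`) vanish exactly on the diagonal
  (`Δ i i = 0`, `Δ i j ≠ 0` for `i ≠ j`), then `m ≤ r·r + r + 1`.  (Degree-2 polynomial method: the indicators
  `1 − Δ(i,·)²` are the rows of the identity matrix and factor through the `r² + r + 1` monomials `1, y_k, y_k y_l`.)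
* `private_pairs_le_rank` — **three-colour private pairs in an affine witness family.**  If colourings
  `c j = b + ∑ k, y j k • s k : Fin n → ZMod 3` (`j < m`) drawn from ONE affine family of dimension `r` have private
  monochromatic pairs (`c i` mono on pair `i`, bichromatic on pair `j ≠ i`), then `m ≤ r² + r + 1`.  With `r = n` and the
  coordinate family this is the (order-sharp, Toft) quadratic cap of BarrierNotesP4g3 (2c)/(3c); its content is the RANK:
  a design whose D2 witnesses span an `r`-dimensional affine family carries at most `r² + r + 1` units, so by the UNIT
  FLOOR (p4 g5: SPREAD ⇒ `m ≥ n·log₂ n + 2Cn`) every system on which the engine fires has witness rank `r ≥ √(n·log₂ n) − 1`.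
  This is the wall that closes the whole "affine / Reed–Muller / potential" door of BarrierNotesP4g3–g5 at once
  (BarrierNotesP4g6 §2): low-rank algebraic witness families are linear-or-worse in `n`, whatever the frame.
* `units_le_rank_of_affine_witnesses` — the same bound instantiated on the engine hypothesis (`IsUnitSystem`, any choice of
  D2 witnesses and of one pair per unit).
* `exists_zeroBisection_of_indep`, `exists_zeroBisection_of_idle` — **INDEPENDENT-HALF WALL**: if some set of at least
  `⌊n/2⌋` vertices contains no unit pair (in particular if at least `⌊n/2⌋` vertices are IDLE, i.e. lie on no unit pair —
  every auxiliary / gadget vertex is idle), the system has a near-bisection splitting no unit, i.e. it satisfies the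
  conclusion of `LinearOrZero` irrespective of `m`.  Gadget-heavy designs (pp-interpretation door, BarrierNotesP4g5 (2b))
  die here before any counting: aux vertices are free padding for the cut player.

`IsUnitSystem`, `unit_mono_of_witness`, `not_isDiag_of_mem` are restated / re-proved verbatim from `UnitFloor.lean`
(Cruxes workfiles are not importable on the farm).

HONEST FRAMING: elementary linear algebra over `ZMod 3` and finite combinatorics; FRONTIER material about one engine for
one crux of one route; nothing here bears on P vs NP.
-/

set_option linter.dupNamespace false

namespace Summit.PneNP.PneNP.Cruxes.FoolingMeasure.P4g6

open Finset
open Summit.PneNP.PneNP.Theorems.AeaCutRectanglesTransversalEngine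
open Summit.PneNP.PneNP.Theorems.AeaCutRectanglesDutyRectangles
open Summit.PneNP.PneNP.Theorems.AeaCutRectanglesClassCuts

/-! ### §1  The witness-rank wall (degree-2 polynomial method over `ZMod 3`) -/

section RankWall

variable {m r : ℕ}

/-- Index set of the monomials `1`, `y_k`, `y_k y_l` in `r` variables (ordered pairs; `r² + r + 1` of them). -/
abbrev MonIdx (r : ℕ) := Option (Fin r ⊕ (Fin r × Fin r))

theorem card_monIdx (r : ℕ) : Fintype.card (MonIdx r) = r * r + r + 1 := by
  simp only [MonIdx, Fintype.card_option, Fintype.card_sum, Fintype.card_fin, Fintype.card_prod]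
  ring

/-- Coefficients of `1 − (a i + ∑ k, d i k · y_k)²` on the monomials (using `−2 = 1` in `ZMod 3`). -/
def coeffMat (a : Fin m → ZMod 3) (d : Fin m → Fin r → ZMod 3) : Matrix (Fin m) (MonIdx r) (ZMod 3) :=
  fun i x => match x with
    | none => 1 - a i ^ 2
    | some (Sum.inl k) => a i * d i k
    | some (Sum.inr (k, l)) => -(d i k * d i l)

/-- Values of the monomials at the parameter vectors `y j`. -/
def monMat (y : Fin m → Fin r → ZMod 3) : Matrix (MonIdx r) (Fin m) (ZMod 3) :=
  fun x j => match x with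
    | none => 1
    | some (Sum.inl k) => y j k
    | some (Sum.inr (k, l)) => y j k * y j l

theorem coeffMat_mul_monMat (a : Fin m → ZMod 3) (d y : Fin m → Fin r → ZMod 3) (i j : Fin m) :
    (coeffMat a d * monMat y) i j = 1 - (a i + ∑ k, y j k * d i k) ^ 2 := by
  set S := ∑ k, y j k * d i k with hS
  have h3 : (3 : ZMod 3) = 0 := by decide
  have e1 : ∑ k, a i * d i k * y j k = a i * S := by
    rw [hS, Finset.mul_sum]
    exact Finset.sum_congr rfl fun k _ => by ring
  have e2 : ∑ k, ∑ l, -(d i k * d i l) * (y j k * y j l) = -(S * S) := by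
    rw [hS, Finset.sum_mul_sum, ← Finset.sum_neg_distrib]
    refine Finset.sum_congr rfl fun k _ => ?_
    rw [← Finset.sum_neg_distrib]
    exact Finset.sum_congr rfl fun l _ => by ring
  rw [Matrix.mul_apply, Fintype.sum_option, Fintype.sum_sum_type, Fintype.sum_prod_type]
  simp only [coeffMat, monMat]
  rw [e1, e2]
  linear_combination (a i * S) * h3

/-- **WITNESS-RANK WALL (abstract form).**  If `Δ i j := a i + ∑ k, y j k * d i k` vanishes exactly on the diagonal then
`m ≤ r² + r + 1`. -/
theorem privateZero_le_rank (a : Fin m → ZMod 3) (d y : Fin m → Fin r → ZMod 3)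
    (hdiag : ∀ i, a i + ∑ k, y i k * d i k = 0)
    (hoff : ∀ i j, i ≠ j → a i + ∑ k, y j k * d i k ≠ 0) : m ≤ r * r + r + 1 := by
  have hsq : ∀ z : ZMod 3, z ≠ 0 → 1 - z ^ 2 = 0 := by decide
  have h1 : coeffMat a d * monMat y = 1 := by
    ext i j
    rw [coeffMat_mul_monMat, Matrix.one_apply]
    by_cases hij : i = j
    · subst hij
      rw [hdiag i, if_pos rfl]
      ring
    · rw [if_neg hij, hsq _ (hoff i j hij)]
  have hr := Matrix.rank_mul_le_left (coeffMat a d) (monMat y)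
  rw [h1, Matrix.rank_one, Fintype.card_fin] at hr
  exact hr.trans ((Matrix.rank_le_card_width _).trans (card_monIdx r).le)

/-- **Three colours: private monochromatic pairs in an `r`-dimensional affine witness family number at most
`r² + r + 1`.**  (`c j = b + ∑ k, y j k • s k`; `c i` is monochromatic on the pair `(u i, v i)` and bichromatic on
`(u j, v j)` for `j ≠ i`.) -/
theorem private_pairs_le_rank {n : ℕ} (b : Fin n → ZMod 3) (s : Fin r → Fin n → ZMod 3)
    (y : Fin m → Fin r → ZMod 3) (c : Fin m → Fin n → ZMod 3)
    (hc : ∀ j w, c j w = b w + ∑ k, y j k * s k w) (u v : Fin m → Fin n)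
    (hmono : ∀ i, c i (u i) = c i (v i)) (hbi : ∀ i j, i ≠ j → c j (u i) ≠ c j (v i)) :
    m ≤ r * r + r + 1 := by
  have hdiff : ∀ i j, c j (u i) - c j (v i)
      = (b (u i) - b (v i)) + ∑ k, y j k * (s k (u i) - s k (v i)) := by
    intro i j
    rw [hc, hc]
    simp only [mul_sub, Finset.sum_sub_distrib]
    ring
  refine privateZero_le_rank (fun i => b (u i) - b (v i)) (fun i k => s k (u i) - s k (v i)) y ?_ ?_
  · intro i
    rw [← hdiff, hmono i, sub_self]
  · intro i j hij h
    exact hbi i j hij (sub_eq_zero.1 ((hdiff i j).trans h))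

/-- The coordinate family (`r = n`, `s k = δ_k`, `y j = c j`, `b = 0`) recovers the plain quadratic cap
`m ≤ n² + n + 1` for ANY three-colour witnesses with private pairs (order-sharp: Toft-type systems have Θ(n²)). -/
theorem private_pairs_le_sq {n : ℕ} (c : Fin m → Fin n → ZMod 3) (u v : Fin m → Fin n)
    (hmono : ∀ i, c i (u i) = c i (v i)) (hbi : ∀ i j, i ≠ j → c j (u i) ≠ c j (v i)) :
    m ≤ n * n + n + 1 := by
  classical
  refine private_pairs_le_rank (r := n) 0 (fun k w => if w = k then 1 else 0) c c ?_ u v hmono hbi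
  intro j w
  simp

end RankWall

/-! ### §2  The engine hypothesis, D2 witnesses, and the rank wall on unit systems -/

/-- A D1 ∧ D2 UNIT SYSTEM on `Fin n` with `m` units: verbatim the first three conjuncts of the hypothesis of
`foolingMeasure_of_spreadSystem` (and verbatim `P4g4.IsUnitSystem` / `P4g5.IsUnitSystem`). -/
def IsUnitSystem (n m : ℕ) (W : Finset (Sym2 (Fin n))) (π : Fin m → Finset (Sym2 (Fin n))) : Prop :=
  (∀ i, (π i).card = 2) ∧
  (∀ t : Fin m → Sym2 (Fin n), (∀ i, t i ∈ π i) →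
    (∀ e ∈ tg W t, ¬ e.IsDiag) ∧ ¬ (SimpleGraph.fromEdgeSet (↑(tg W t) : Set (Sym2 (Fin n)))).Colorable 3) ∧
  (∀ i, (SimpleGraph.fromEdgeSet (↑(gammaMinus W π i) : Set (Sym2 (Fin n)))).Colorable 3)

variable {n m : ℕ} {W : Finset (Sym2 (Fin n))} {π : Fin m → Finset (Sym2 (Fin n))}

theorem unit_nonempty (hsys : IsUnitSystem n m W π) (i : Fin m) : (π i).Nonempty :=
  card_pos.1 (by rw [hsys.1 i]; norm_num)

/-- Every unit pair is loopless.  [Verbatim `P4g5.not_isDiag_of_mem`.] -/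
theorem not_isDiag_of_mem (hsys : IsUnitSystem n m W π) {i : Fin m} {e : Sym2 (Fin n)} (he : e ∈ π i) :
    ¬ e.IsDiag := by
  classical
  let t : Fin m → Sym2 (Fin n) := fun j => if j = i then e else (unit_nonempty hsys j).choose
  have ht : ∀ j, t j ∈ π j := by
    intro j
    by_cases hj : j = i
    · subst hj; simp [t, he]
    · simp [t, hj, (unit_nonempty hsys j).choose_spec]
  have h := (hsys.2.1 t ht).1 (t i) (mem_tg.2 (Or.inr ⟨i, rfl⟩))
  simpa [t] using h

/-- A D2 witness of unit `i` makes BOTH pairs of unit `i` monochromatic.  [Verbatim `P4g5.unit_mono_of_witness`.] -/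
theorem unit_mono_of_witness (hsys : IsUnitSystem n m W π) {i : Fin m} {c : Fin n → Fin 3}
    (hc : c ∉ killSet (gammaMinus W π i)) {e : Sym2 (Fin n)} (he : e ∈ π i) : (e.map c).IsDiag := by
  classical
  let t : Fin m → Sym2 (Fin n) := fun j => if j = i then e else (unit_nonempty hsys j).choose
  have ht : ∀ j, t j ∈ π j := by
    intro j
    by_cases hj : j = i
    · subst hj; simp [t, he]
    · simp [t, hj, (unit_nonempty hsys j).choose_spec]
  obtain ⟨-, hnc⟩ := hsys.2.1 t ht
  obtain ⟨e', he', hd', hm'⟩ := (not_colorable_iff_forall_mem_killSet _).1 hnc c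
  rcases mem_tg.1 he' with hW | ⟨j, rfl⟩
  · exact absurd ⟨e', mem_gammaMinus.2 (Or.inl hW), hd', hm'⟩ hc
  · by_cases hj : j = i
    · subst hj; simpa [t] using hm'
    · exact absurd ⟨t j, mem_gammaMinus.2 (Or.inr ⟨j, hj, ht j⟩), hd', hm'⟩ hc

/-- D2 witnesses exist (one proper 3-colouring of `Γ − πᵢ` per unit). -/
theorem exists_witnesses (hsys : IsUnitSystem n m W π) :
    ∃ c : Fin m → Fin n → Fin 3, ∀ i, c i ∉ killSet (gammaMinus W π i) :=
  ⟨fun i => ((colorable_iff_exists_not_mem_killSet _).1 (hsys.2.2 i)).choose,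
    fun i => ((colorable_iff_exists_not_mem_killSet _).1 (hsys.2.2 i)).choose_spec⟩

/-- PRIVACY of any chosen pair: a D2 witness of unit `j ≠ i` is bichromatic on every pair of unit `i`. -/
theorem witness_bichromatic (hsys : IsUnitSystem n m W π) {i j : Fin m} (hij : i ≠ j) {c : Fin n → Fin 3}
    (hc : c ∉ killSet (gammaMinus W π j)) {a b : Fin n} (hab : s(a, b) ∈ π i) : c a ≠ c b := by
  intro h
  exact hc ⟨s(a, b), mem_gammaMinus.2 (Or.inr ⟨i, hij, hab⟩), not_isDiag_of_mem hsys hab,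
    (map_mk_isDiag_iff c a b).2 h⟩

/-- **WITNESS-RANK WALL on the engine hypothesis.**  If a D1 ∧ D2 unit system admits D2 witnesses all drawn from one
affine family `w ↦ b w + ∑ k, y j k * s k w` of dimension `r` (read in `ZMod 3 = Fin 3`), then `m ≤ r² + r + 1`. -/
theorem units_le_rank_of_affine_witnesses {r : ℕ} (hsys : IsUnitSystem n m W π)
    (c : Fin m → Fin n → ZMod 3) (hc : ∀ i, c i ∉ killSet (gammaMinus W π i))
    (u v : Fin m → Fin n) (huv : ∀ i, s(u i, v i) ∈ π i)
    (b : Fin n → ZMod 3) (s : Fin r → Fin n → ZMod 3) (y : Fin m → Fin r → ZMod 3)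
    (haff : ∀ j w, c j w = b w + ∑ k, y j k * s k w) : m ≤ r * r + r + 1 := by
  refine private_pairs_le_rank b s y c haff u v ?_ ?_
  · intro i
    exact (map_mk_isDiag_iff (c i) (u i) (v i)).1 (unit_mono_of_witness hsys (hc i) (huv i))
  · intro i j hij
    exact witness_bichromatic hsys hij (hc j) (huv i)

/-- Unconditionally (coordinate family): a D1 ∧ D2 unit system on `Fin n` has at most `n² + n + 1` units.
(Weaker than the trivial `2m ≤ n(n−1)/2` from disjointness of unit pairs — recorded only to make the point of
BarrierNotesP4g6 §2 that the CONTENT of the degree-2 cap is the rank `r`, not the count.) -/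
theorem units_le_sq (hsys : IsUnitSystem n m W π) : m ≤ n * n + n + 1 := by
  classical
  obtain ⟨c, hc⟩ := exists_witnesses hsys
  have hpair : ∀ i, ∃ p : Fin n × Fin n, s(p.1, p.2) ∈ π i := by
    intro i
    obtain ⟨e, he⟩ := unit_nonempty hsys i
    induction e using Sym2.ind with
    | h a b => exact ⟨(a, b), he⟩
  choose p hp using hpair
  refine private_pairs_le_sq (fun i => (c i : Fin n → ZMod 3)) (fun i => (p i).1) (fun i => (p i).2) ?_ ?_
  · intro i
    exact (map_mk_isDiag_iff (c i) _ _).1 (unit_mono_of_witness hsys (hc i) (hp i))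
  · intro i j hij
    exact witness_bichromatic hsys hij (hc j) (hp i)

/-! ### §3  The independent-half wall: zero bisections from independent or idle halves -/

/-- A cut containing no unit pair splits no unit. -/
theorem splitUnits_eq_empty_of_noPairInside {B : Finset (Fin n)} (h : ∀ i, ∀ e ∈ π i, ∃ v ∈ e, v ∉ B) :
    splitUnits π B = ∅ := by
  refine eq_empty_of_forall_notMem fun i hi => ?_
  obtain ⟨⟨e, he, heB⟩, -⟩ := mem_splitUnits.1 hi
  obtain ⟨v, hv, hvB⟩ := h i e he
  exact hvB (heB v hv)

/-- **INDEPENDENT-HALF WALL.**  If some set of at least `⌊n/2⌋` vertices contains no unit pair, there is a near-bisection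
(`⌊n/2⌋ ≤ |B| ≤ ⌈n/2⌉`) splitting no unit — the conclusion of `LinearOrZero`, whatever `m` is. -/
theorem exists_zeroBisection_of_indep (I : Finset (Fin n)) (hI : n / 2 ≤ I.card)
    (h : ∀ i, ∀ e ∈ π i, ∃ v ∈ e, v ∉ I) :
    ∃ B : Finset (Fin n), n / 2 ≤ B.card ∧ B.card ≤ (n + 1) / 2 ∧ splitUnits π B = ∅ := by
  obtain ⟨B, hBI, hB⟩ := Finset.exists_subset_card_eq hI
  refine ⟨B, hB.symm.le, by omega, splitUnits_eq_empty_of_noPairInside fun i e he => ?_⟩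
  obtain ⟨v, hv, hvI⟩ := h i e he
  exact ⟨v, hv, fun hvB => hvI (hBI hvB)⟩

/-- The IDLE vertices of a unit system: those lying on no unit pair (every auxiliary / gadget vertex of a frame). -/
def idle (π : Fin m → Finset (Sym2 (Fin n))) : Finset (Fin n) :=
  univ.filter fun v => ∀ i, ∀ e ∈ π i, v ∉ e

theorem mem_idle {v : Fin n} : v ∈ idle π ↔ ∀ i, ∀ e ∈ π i, v ∉ e := by
  simp [idle]

/-- **IDLE-HALF WALL.**  If at least `⌊n/2⌋` vertices are idle, some near-bisection splits no unit: gadget vertices are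
free padding for the cut player, so a design spending at least as many auxiliary vertices as it has pair-carrying ones is
dead irrespective of its unit count. -/
theorem exists_zeroBisection_of_idle (hidle : n / 2 ≤ (idle π).card) :
    ∃ B : Finset (Fin n), n / 2 ≤ B.card ∧ B.card ≤ (n + 1) / 2 ∧ splitUnits π B = ∅ := by
  refine exists_zeroBisection_of_indep (idle π) hidle fun i e he => ?_
  induction e using Sym2.ind with
  | h a b => exact ⟨a, Sym2.mem_mk_left a b, fun ha => (mem_idle.1 ha) i _ he (Sym2.mem_mk_left a b)⟩

/-! ### §4  Dense critical cores are forced: every 4-critical part of a transversal graph swallows the transversal -/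

/-- In a D1 ∧ D2 unit system, a NON-3-colourable subgraph `H` of a transversal graph `W ∪ t` contains every transversal
edge `t i` (else `H ⊆ Γ − πᵢ`, which D2 colours).  Hence every 4-critical core of every transversal graph has at least
`m` edges on at most `n` vertices: with the unit floor (`m ≥ n·log₂ n + 2Cn` under SPREAD) a spread system is a
simultaneous family of `2^m` superlinear-size 4-critical graphs sharing the frame (BarrierNotesP4g6 §4). -/
theorem transversal_mem_of_not_colorable (hsys : IsUnitSystem n m W π) {t : Fin m → Sym2 (Fin n)}
    (ht : ∀ i, t i ∈ π i) {H : Finset (Sym2 (Fin n))} (hH : H ⊆ tg W t)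
    (hnc : ¬ (SimpleGraph.fromEdgeSet (↑H : Set (Sym2 (Fin n)))).Colorable 3) (i : Fin m) : t i ∈ H := by
  by_contra hti
  have hsub : (↑H : Set (Sym2 (Fin n))) ⊆ ↑(gammaMinus W π i) := by
    intro e he
    have he' : e ∈ H := by simpa using he
    rcases mem_tg.1 (hH he') with hW | ⟨j, rfl⟩
    · exact mem_coe.2 (mem_gammaMinus.2 (Or.inl hW))
    · have hj : j ≠ i := by rintro rfl; exact hti he'
      exact mem_coe.2 (mem_gammaMinus.2 (Or.inr ⟨j, hj, ht j⟩))
  exact hnc ((hsys.2.2 i).mono_left (SimpleGraph.fromEdgeSet_mono hsub))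

/-- Consequently such a core has at least `m` edges. -/
theorem le_card_of_not_colorable (hsys : IsUnitSystem n m W π) {t : Fin m → Sym2 (Fin n)}
    (ht : ∀ i, t i ∈ π i) {H : Finset (Sym2 (Fin n))} (hH : H ⊆ tg W t)
    (hnc : ¬ (SimpleGraph.fromEdgeSet (↑H : Set (Sym2 (Fin n)))).Colorable 3) : m ≤ H.card := by
  classical
  have hinj : Function.Injective t := by
    intro i j hij
    by_contra hne
    have h1 : t i ∈ π i := ht i
    have h2 : t i ∈ π j := hij ▸ ht j
    -- units are disjoint: a common edge of `π i` and `π j` would lie in `Γ − πᵢ`'s complement and in `Γ − πⱼ`;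
    -- the D2 witness of unit `i` is monochromatic on it (unit_mono_of_witness) yet proper on `π j` (witness_bichromatic).
    obtain ⟨c, hc⟩ := exists_witnesses hsys
    induction h : t i using Sym2.ind with
    | h a b =>
      rw [h] at h1 h2
      exact witness_bichromatic hsys (Ne.symm hne) (hc i) h2 ((map_mk_isDiag_iff (c i) a b).1
        (unit_mono_of_witness hsys (hc i) h1))
  calc m = (univ.image t).card := by rw [card_image_of_injective _ hinj, card_univ, Fintype.card_fin]
    _ ≤ H.card := card_le_card fun e he => by
        obtain ⟨i, -, rfl⟩ := mem_image.1 he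
        exact transversal_mem_of_not_colorable hsys ht hH hnc i

end Summit.PneNP.PneNP.Cruxes.FoolingMeasure.P4g6
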